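import Summits.QuantumFields.YangMills.Theorems.BalabanUVNodesN22JointChartsRealU1Model
import Literature.Analysis.Complex.SeparatelyHolomorphicStrips

/-!
# BalabanUVNodes ∕ node N22 = NE9 — A6 AT THE ACTIVITY LEVEL FOR THE ANALYTIC ROAD (ROAD 3), part 2∕3: AT THE REAL U(1) MODEL TOWERS the three activity-chart
# binders `hℋ ∕ hMℋ ∕ hfℋ` of `…N22JointChartsOfActivityJointHolo` §2 HOLD, ITS §2 FIRES (per-term joint OUTPUT charts with the (1.18)-type bound), and the reality
# binder `hIm` of `…N22WindowedCouplingHoloOfLocalTerms` §2 HOLDS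

WIDTH SEAT dag-n22-w1 (harness re-seat g5), piece C7 of its own lineage, part 2 (part 1 = `…N22JointChartsRealU1Model`, p634063: the REAL U(1) model step, realness of
(2.13) for real activities, the joint chart and its three clauses at the STEP level).  Cell `pub-ymgap`, HUMAN RULING D-0062 (Track A) ∕ D-0149; `--kind proof --supports
stmt-QuantumFields-27366 --as helper` (K3⁸ `SpineGivenEndpointR13SepCoPHV`, KEY MAP v2), COUNT-NEUTRAL.  THEOREMS ONLY (0 `def`, 0 `sorry`, standard axioms).  Imports part 1
only (through it C6 `…N22JointChartsOfActivityJointHolo` p631151 and dag-n22-w2's `…NonzeroChartModel` p610496: `tailWeight_pos ∕ tailWeight_mono`).  Nothing re-declared.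

WHAT (all [folklore]; MODEL level).  THE TOWERS: on every torus `K` and level `k`, activities given by the real U(1) display `hS` of part 1 with dag-n22-w2's site weights
`w_X(t) = B₃e^{−δ₀ distCT(cast t, nearT X)}` (= the p. 282 tails); the objects fed to C6 §2 are ALL EXPLICIT: reading `emb K k W = (b ↦ ½(W_{b.dir}(t_b) + W_{b.dir}(t_b)⁻¹), 0)`,
chart `ρ = (x ↦ ix)`, `Ec K k = (Fin d → Site_{k+1} → ℂ)`, the INJECTIVE complexification `ι_X B = (B_{l,t}·w_X(t))` (dag-n22-w2's, as a continuous linear map), coupling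
domain `Dt = {|Im τ| < s}`, and the JOINT CHART FAMILY `ℋ K k h m X Z (τ, z) = A e^{−R d(Z)}·cos(Σ_j (h|h_m:=0)_j ω^{k+1−j} + τ·c_m)·(1∕N)Σ e^{−r∕w_Z(t̃)} cos(z_{l,t̃}∕w_X(t̃))`
(`c_m = ω^{k+1−m}` for `m ≤ k`, else `0`).
* §4 (the strip is open: Literature `isOpen_setOf_abs_im_lt`, cited) `closedBall_ofReal_subset_strip` (the `hdisc` clause of C4 §2 ∕ C6 §3 for the strip, `r₀ < s`), `half_exp_add_inv_im` (`½(e^{ix} + (e^{ix})⁻¹)` is real).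
* §4b STEP-LEVEL CERTIFICATES that the chart READS BOTH VARIABLES (pure identities, any weights): `jointChart_tau_antiperiodic` (`τ ↦ τ + π∕c` flips the sign, `c ≠ 0`),
  `jointChart_field_zero_and_quarter` (at `z = 0` the read-out is `(1∕N)Σ e^{−r∕w_Z}`; at the quarter-period field `z_{l,s} = (π∕2)·w_X(s)` the chart VANISHES).
* §5 AT THE TOWERS: ★ `hHolo_realU1` (C6 §2's `hℋ`: `ℋ` differentiable on `Dt × ball(0, r)` — it is entire), ★ `hBound_realU1` (`hMℋ` with amplitude `A e^{s}` and rate `R`: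
  `0 ≤ A`, `0 ≤ ω ≤ 1`, `δ₀ ≥ 0`, `B₃ > 0`; the field radius IS the model's read-out letter `r`, so that `e^{−r∕w_Z}e^{‖z‖∕w_X} ≤ 1`), ★ `hAgree_realU1` (`hfℋ`: agreement at
  `(t, ι_X B)` with `H(Z; (h|h_m:=t)_{≤k}; emb(e^{iB}))`), ★ `hIm_realU1` (C4 §2's reality binder: the (2.13) terms at `emb(e^{iB})` are REAL), ★★
  `jointCharts_of_activityJointCharts_fires_realU1` (C6 §2 APPLIES under Road 1's numerals for `A e^{s}` and returns its three OUTPUT-chart binders `h𝒢 ∕ hM𝒢 ∕ hf` for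
  `𝒢 := locE ∘ ℋ`, letters `(B, κ_E) = (e·9·64·K₀(64,8)²·A e^{s}, r₁)` — the per-term joint output charts that C4 §2 consumes; part 3 fires C4 §2).

HONEST FRAMING (binding).  An A6 MODEL WITNESS (abelian toy on Bałaban's torus bookkeeping), count-neutral: joint satisfiability + non-degeneracy of the activity-level
antecedent of the analytic road and the elaboration of C6 §2 end to end there.  NOT NODE 00's tower, NOT the minimizer reading, NOT print's chart `θ.ρ8`, NOT gauge-covariant;
nothing of the record is claimed to meet anything; nothing of Bałaban's asserted or constructed ([I] = CMP 109 (1987) p. 263, (1.18)–(1.21) p. 264, p. 282; [II] = CMP 116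
(1988) (2.13)–(2.14) pp. 14–15, (2.38) p. 20 — TYPES only); N18's kernel step rate ∕ (1.21) existence NOT claimed; N22 NOT discharged (typed 28∕28 · discharged 5∕27
UNCHANGED — the chair's single count line is the only count); K3⁸ OPEN, NOT claimed, no stub touched; one finite 𝕋⁴ programme at fixed ε — R4 closes the CONDITIONAL rung
`BalabanLadder.UV` only; NOTHING about the continuum limit, ℝ⁴, OS axioms, a mass gap or the Clay problem is proved or claimed by any of this.
-/

noncomputable section

open Filter Topology Set Metric
open scoped BigOperators

namespace YMDAG.N22.JointHoloLocalTerms.RealU1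

open Literature.MathematicalPhysics.QuantumFieldTheory.Balaban1983to89
open Literature.MathematicalPhysics.QuantumFieldTheory.Balaban1983to89.T4Continuum (T4Family)
open Literature.MathematicalPhysics.QuantumFieldTheory.Balaban1983to89.T4OutputRate (Window)
open Literature.MathematicalPhysics.QuantumFieldTheory.Balaban1983to89.Node00.Sect2 (domCount domSys CPair)
open Literature.MathematicalPhysics.QuantumFieldTheory.Balaban1983to89.Node00.W1 (ClusterTower ClusterStep)
open Literature.MathematicalPhysics.QuantumFieldTheory.Balaban1983to89.Node00.U3OfKernels (histPrefix histPrefix_apply)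
open Literature.MathematicalPhysics.QuantumFieldTheory.Balaban1983to89.Node00.LocalizedSum17 (ReadingMaps)
open Literature.MathematicalPhysics.QuantumFieldTheory.Balaban1983to89.B13Resummation (locE)
open Literature.MathematicalPhysics.QuantumFieldTheory.Balaban1983to89.B12TreeDecay (K₀ kappa₀ K₀_pos kappa₀_nonneg)
open Literature.MathematicalPhysics.QuantumFieldTheory.Balaban1983to89.B12Decay510Torus (distCT nearT)
open Literature.MathematicalPhysics.QuantumFieldTheory.Balaban1983to89.TreeLengthTorus (TPt TDom)
open Literature.MathematicalPhysics.QuantumFieldTheory.Balaban1983to89.TreeLengthTorusGeometry (TTouch)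
open Literature.MathematicalPhysics.QuantumFieldTheory.Balaban1983to89.B14.Eq22Determines (blockIter)
open Literature.MathematicalPhysics.QuantumFieldTheory.Balaban1983to89.B15DeterminingSets (embIter)
open YMDAG.N22.WindowSoftTwoPoint.NonzeroChart (tailWeight_pos tailWeight_mono)
open YMDAG.N22.JointHoloLocalTerms (jointCharts_of_activityJointCharts)
open Literature.Analysis.Complex (isOpen_setOf_abs_im_lt)

/-! ## §4 The coupling strip, and the reality of the self-adjoint read-out -/

/-- The closed `r₀`-disc about a real point lies in the strip `{|Im τ| < s}` when `r₀ < s` (the `hdisc` clause of C4 §2 ∕ C6 §3 for `Dt` = the strip). [folklore] -/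
theorem closedBall_ofReal_subset_strip (t : ℝ) {r₀ s : ℝ} (h : r₀ < s) : closedBall (t : ℂ) r₀ ⊆ {τ : ℂ | |τ.im| < s} := by
  intro z hz
  rw [mem_closedBall, dist_eq_norm] at hz
  have him : |z.im| ≤ r₀ :=
    calc |z.im| = |(z - (t : ℂ)).im| := by simp
      _ ≤ ‖z - (t : ℂ)‖ := Complex.abs_im_le_norm _
      _ ≤ r₀ := hz
  exact lt_of_le_of_lt him h

/-- The self-adjoint part `½(e^{ix} + (e^{ix})⁻¹) = cos x` of a U(1) holonomy is REAL (chart `ρ = (x ↦ ix)`). [folklore] -/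
theorem half_exp_add_inv_im (x : ℝ) :
    ((NormedSpace.exp (((ContinuousLinearMap.id ℝ ℝ).smulRight Complex.I) x) + (NormedSpace.exp (((ContinuousLinearMap.id ℝ ℝ).smulRight Complex.I) x))⁻¹) / 2).im
      = 0 := by
  rw [← ccos_mul_div_eq_half_exp_add_inv x 1 one_ne_zero, mul_div_assoc, div_self (by norm_num : ((1 : ℝ) : ℂ) ≠ 0), mul_one]
  exact Complex.cos_ofReal_im x


/-! ## §4b Step-level certificates: the joint chart READS BOTH VARIABLES (pure chart identities; any weights) -/

section StepCertificates

variable {P : Params} {M k : ℕ} (wt : (domSys P M (k + 1)).Dom → Site P (k + 1) → ℝ) {A R r : ℝ}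

/-- **THE CHART READS THE COUPLING**: shifting `τ` by the half-period `π∕c` FLIPS THE SIGN of the joint chart (`c ≠ 0`). [folklore] -/
theorem jointChart_tau_antiperiodic (wX : Site P (k + 1) → ℝ) (Z : (domSys P M (k + 1)).Dom) (a : ℝ) {c : ℝ} (hc : c ≠ 0)
    (p : ℂ × (Fin P.d → Site P (k + 1) → ℂ)) :
    ((A * Real.exp (-(R * (domSys P M (k + 1)).dj Z)) : ℝ) : ℂ) * Complex.cos ((a : ℂ) + (p.1 + (Real.pi / c : ℝ)) * (c : ℂ)) *
        (((Fintype.card (Fin P.d × Site P (k + 1)) : ℂ))⁻¹ *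
          ∑ lt : Fin P.d × Site P (k + 1), ((Real.exp (-(r / wt Z (blockIter (k + 1) (embIter (k + 1) lt.2)))) : ℝ) : ℂ) *
            Complex.cos (p.2 lt.1 (blockIter (k + 1) (embIter (k + 1) lt.2)) / (wX (blockIter (k + 1) (embIter (k + 1) lt.2)) : ℂ))) =
      -(((A * Real.exp (-(R * (domSys P M (k + 1)).dj Z)) : ℝ) : ℂ) * Complex.cos ((a : ℂ) + p.1 * (c : ℂ)) *
        (((Fintype.card (Fin P.d × Site P (k + 1)) : ℂ))⁻¹ *
          ∑ lt : Fin P.d × Site P (k + 1), ((Real.exp (-(r / wt Z (blockIter (k + 1) (embIter (k + 1) lt.2)))) : ℝ) : ℂ) *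
            Complex.cos (p.2 lt.1 (blockIter (k + 1) (embIter (k + 1) lt.2)) / (wX (blockIter (k + 1) (embIter (k + 1) lt.2)) : ℂ)))) := by
  have hc' : (c : ℂ) ≠ 0 := Complex.ofReal_ne_zero.2 hc
  have hshift : (a : ℂ) + (p.1 + (Real.pi / c : ℝ)) * (c : ℂ) = ((a : ℂ) + p.1 * (c : ℂ)) + Real.pi := by
    push_cast; field_simp; ring
  rw [hshift, Complex.cos_add_pi]
  ring

/-- **THE CHART READS THE FIELD**: at the zero field the read-out is the positive average `(1∕N) Σ e^{−r∕w_Z}` (`cos 0 = 1`), while at the quarter-period field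
`z_{l,s} = (π∕2)·w_X(s)` EVERY read-out vanishes (`cos(π∕2) = 0`) and the chart is `0`. [folklore] -/
theorem jointChart_field_zero_and_quarter (wX : Site P (k + 1) → ℝ) (hwX : ∀ t, wX t ≠ 0) (Z : (domSys P M (k + 1)).Dom) (a c : ℝ) (τ : ℂ) :
    (((A * Real.exp (-(R * (domSys P M (k + 1)).dj Z)) : ℝ) : ℂ) * Complex.cos ((a : ℂ) + τ * (c : ℂ)) *
        (((Fintype.card (Fin P.d × Site P (k + 1)) : ℂ))⁻¹ *
          ∑ lt : Fin P.d × Site P (k + 1), ((Real.exp (-(r / wt Z (blockIter (k + 1) (embIter (k + 1) lt.2)))) : ℝ) : ℂ) *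
            Complex.cos ((0 : Fin P.d → Site P (k + 1) → ℂ) lt.1 (blockIter (k + 1) (embIter (k + 1) lt.2)) / (wX (blockIter (k + 1) (embIter (k + 1) lt.2)) : ℂ))) =
      ((A * Real.exp (-(R * (domSys P M (k + 1)).dj Z)) : ℝ) : ℂ) * Complex.cos ((a : ℂ) + τ * (c : ℂ)) *
        (((Fintype.card (Fin P.d × Site P (k + 1)) : ℂ))⁻¹ *
          ∑ lt : Fin P.d × Site P (k + 1), ((Real.exp (-(r / wt Z (blockIter (k + 1) (embIter (k + 1) lt.2)))) : ℝ) : ℂ))) ∧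
    (((A * Real.exp (-(R * (domSys P M (k + 1)).dj Z)) : ℝ) : ℂ) * Complex.cos ((a : ℂ) + τ * (c : ℂ)) *
        (((Fintype.card (Fin P.d × Site P (k + 1)) : ℂ))⁻¹ *
          ∑ lt : Fin P.d × Site P (k + 1), ((Real.exp (-(r / wt Z (blockIter (k + 1) (embIter (k + 1) lt.2)))) : ℝ) : ℂ) *
            Complex.cos ((fun (_ : Fin P.d) (s : Site P (k + 1)) => ((Real.pi / 2 * wX s : ℝ) : ℂ)) lt.1 (blockIter (k + 1) (embIter (k + 1) lt.2)) /
              (wX (blockIter (k + 1) (embIter (k + 1) lt.2)) : ℂ))) = 0) := by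
  constructor
  · simp only [Pi.zero_apply, zero_div, Complex.cos_zero, mul_one]
  · have hq : ∀ s : Site P (k + 1), Complex.cos (((Real.pi / 2 * wX s : ℝ) : ℂ) / (wX s : ℂ)) = 0 := fun s => by
      have hw : (wX s : ℂ) ≠ 0 := Complex.ofReal_ne_zero.2 (hwX s)
      rw [show ((Real.pi / 2 * wX s : ℝ) : ℂ) / (wX s : ℂ) = (Real.pi / 2 : ℝ) by push_cast; field_simp, ← Complex.ofReal_cos, Real.cos_pi_div_two,
        Complex.ofReal_zero]
    simp only [hq, mul_zero, Finset.sum_const_zero]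

end StepCertificates

/-! ## §5 AT THE REAL U(1) MODEL TOWERS: the three activity-chart binders of C6 §2 HOLD, C6 §2 FIRES, the reality binder `hIm` HOLDS -/

section Tower

variable (F : T4Family) (M : ℕ) [NeZero M] (S : (K : ℕ) → ClusterTower (F.P K) ℂ M) {A R ω r δ₀ B₃ : ℝ}
variable (hS : ∀ (K k : ℕ) (g : Fin (k + 1) → ℝ) (φ : CPair (F.P K) ℂ) (Z : (domSys (F.P K) M (k + 1)).Dom),
  ((S K) k).H g φ Z = ((A * Real.exp (-(R * (domSys (F.P K) M (k + 1)).dj Z)) * Real.cos (∑ i : Fin (k + 1), g i * ω ^ (k + 1 - (i : ℕ))) : ℝ) : ℂ) *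
    (((Fintype.card (Fin (F.P K).d × Site (F.P K) (k + 1)) : ℂ))⁻¹ *
      ∑ lt : Fin (F.P K).d × Site (F.P K) (k + 1), ((Real.exp (-(r / (B₃ * Real.exp (-δ₀ * distCT (domCount (F.P K) M (k + 1)) M (fun i => (ZMod.cast (((blockIter (k + 1) (embIter (k + 1) lt.2))) i) : ZMod (domCount (F.P K) M (k + 1) * M))) (nearT (M := M) (fun i => (ZMod.cast (((blockIter (k + 1) (embIter (k + 1) lt.2))) i) : ZMod (domCount (F.P K) M (k + 1) * M))) Z))))) : ℝ) : ℂ) *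
        φ.1 ⟨embIter (k + 1) lt.2, lt.1⟩))

/-- ★ **`hℋ` HOLDS AT THE MODEL**: every joint chart `ℋ K k h m X Z` of the real U(1) towers (phase offset `Σ_j (h|h_m:=0)_j ω^{k+1−j}`, slope `ω^{k+1−m}` or `0`, weights
`w_X` = the p. 282 tails) is complex-differentiable on `{|Im τ| < s} × ball(0, r)` — on any set: it is ENTIRE (part 1 `differentiable_jointChart`). [folklore] -/
theorem hHolo_realU1 (γ s : ℝ) :
    ∀ (K k : ℕ), ∀ h ∈ Window γ, ∀ (m : ℕ) (X Z : (domSys (F.P K) M (k + 1)).Dom), Z.1 ⊆ X.1 →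
      DifferentiableOn ℂ ((fun (K k : ℕ) (h : ℕ → ℝ) (m : ℕ) (X Z : (domSys (F.P K) M (k + 1)).Dom) (p : ℂ × (Fin (F.P K).d → Site (F.P K) (k + 1) → ℂ)) =>
        ((A * Real.exp (-(R * (domSys (F.P K) M (k + 1)).dj Z)) : ℝ) : ℂ) *
            Complex.cos (((∑ j : Fin (k + 1), histPrefix (Function.update h m 0) k j * ω ^ (k + 1 - (j : ℕ)) : ℝ) : ℂ) +
              p.1 * ((if m < k + 1 then ω ^ (k + 1 - m) else 0 : ℝ) : ℂ)) *
          (((Fintype.card (Fin (F.P K).d × Site (F.P K) (k + 1)) : ℂ))⁻¹ *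
            ∑ lt : Fin (F.P K).d × Site (F.P K) (k + 1), ((Real.exp (-(r / (B₃ * Real.exp (-δ₀ * distCT (domCount (F.P K) M (k + 1)) M (fun i => (ZMod.cast (((blockIter (k + 1) (embIter (k + 1) lt.2))) i) : ZMod (domCount (F.P K) M (k + 1) * M))) (nearT (M := M) (fun i => (ZMod.cast (((blockIter (k + 1) (embIter (k + 1) lt.2))) i) : ZMod (domCount (F.P K) M (k + 1) * M))) Z))))) : ℝ) : ℂ) *
              Complex.cos (p.2 lt.1 (blockIter (k + 1) (embIter (k + 1) lt.2)) / (((B₃ * Real.exp (-δ₀ * distCT (domCount (F.P K) M (k + 1)) M (fun i => (ZMod.cast (((blockIter (k + 1) (embIter (k + 1) lt.2))) i) : ZMod (domCount (F.P K) M (k + 1) * M))) (nearT (M := M) (fun i => (ZMod.cast (((blockIter (k + 1) (embIter (k + 1) lt.2))) i) : ZMod (domCount (F.P K) M (k + 1) * M))) X))) : ℝ) : ℂ)))) K k h m X Z)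
        ({τ : ℂ | |τ.im| < s} ×ˢ ball (0 : Fin (F.P K).d → Site (F.P K) (k + 1) → ℂ) r) := by
  intro K k h _ m X Z _
  let wt : (K k : ℕ) → (domSys (F.P K) M (k + 1)).Dom → Site (F.P K) (k + 1) → ℝ := fun K k X t =>
    (B₃ * Real.exp (-δ₀ * distCT (domCount (F.P K) M (k + 1)) M (fun i => (ZMod.cast ((t) i) : ZMod (domCount (F.P K) M (k + 1) * M))) (nearT (M := M) (fun i => (ZMod.cast ((t) i) : ZMod (domCount (F.P K) M (k + 1) * M))) X)))
  exact (differentiable_jointChart (A := A) (R := R) (r := r) (wt K k) (wt K k X) Z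
    (∑ j : Fin (k + 1), histPrefix (Function.update h m 0) k j * ω ^ (k + 1 - (j : ℕ))) (if m < k + 1 then ω ^ (k + 1 - m) else 0)).differentiableOn

/-- ★ **`hMℋ` HOLDS AT THE MODEL** with amplitude `A·e^{s}` and rate `R`: on `{|Im τ| < s} × ball(0, r)`, for `Z ⊆ X`, `‖ℋ K k h m X Z (τ, z)‖ ≤ A e^{s}·e^{−R d_{k+1}(Z)}`
(`0 ≤ A`, `0 ≤ ω ≤ 1`, `δ₀ ≥ 0`, `B₃ > 0`; part 1 `norm_jointChart_le` + dag-n22-w2's `tailWeight_pos ∕ tailWeight_mono`). [folklore] -/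
theorem hBound_realU1 (γ s : ℝ) (hA : 0 ≤ A) (hω0 : 0 ≤ ω) (hω1 : ω ≤ 1) (hδ₀ : 0 ≤ δ₀) (hB₃ : 0 < B₃) :
    ∀ (K k : ℕ), ∀ h ∈ Window γ, ∀ (m : ℕ) (X Z : (domSys (F.P K) M (k + 1)).Dom), Z.1 ⊆ X.1 →
      ∀ p ∈ {τ : ℂ | |τ.im| < s} ×ˢ ball (0 : Fin (F.P K).d → Site (F.P K) (k + 1) → ℂ) r,
        ‖(fun (K k : ℕ) (h : ℕ → ℝ) (m : ℕ) (X Z : (domSys (F.P K) M (k + 1)).Dom) (p : ℂ × (Fin (F.P K).d → Site (F.P K) (k + 1) → ℂ)) =>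
        ((A * Real.exp (-(R * (domSys (F.P K) M (k + 1)).dj Z)) : ℝ) : ℂ) *
            Complex.cos (((∑ j : Fin (k + 1), histPrefix (Function.update h m 0) k j * ω ^ (k + 1 - (j : ℕ)) : ℝ) : ℂ) +
              p.1 * ((if m < k + 1 then ω ^ (k + 1 - m) else 0 : ℝ) : ℂ)) *
          (((Fintype.card (Fin (F.P K).d × Site (F.P K) (k + 1)) : ℂ))⁻¹ *
            ∑ lt : Fin (F.P K).d × Site (F.P K) (k + 1), ((Real.exp (-(r / (B₃ * Real.exp (-δ₀ * distCT (domCount (F.P K) M (k + 1)) M (fun i => (ZMod.cast (((blockIter (k + 1) (embIter (k + 1) lt.2))) i) : ZMod (domCount (F.P K) M (k + 1) * M))) (nearT (M := M) (fun i => (ZMod.cast (((blockIter (k + 1) (embIter (k + 1) lt.2))) i) : ZMod (domCount (F.P K) M (k + 1) * M))) Z))))) : ℝ) : ℂ) *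
              Complex.cos (p.2 lt.1 (blockIter (k + 1) (embIter (k + 1) lt.2)) / (((B₃ * Real.exp (-δ₀ * distCT (domCount (F.P K) M (k + 1)) M (fun i => (ZMod.cast (((blockIter (k + 1) (embIter (k + 1) lt.2))) i) : ZMod (domCount (F.P K) M (k + 1) * M))) (nearT (M := M) (fun i => (ZMod.cast (((blockIter (k + 1) (embIter (k + 1) lt.2))) i) : ZMod (domCount (F.P K) M (k + 1) * M))) X))) : ℝ) : ℂ)))) K k h m X Z p‖ ≤ A * Real.exp s * Real.exp (-(R * (domSys (F.P K) M (k + 1)).dj Z)) := by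
  intro K k h _ m X Z hZX p hp
  let wt : (K k : ℕ) → (domSys (F.P K) M (k + 1)).Dom → Site (F.P K) (k + 1) → ℝ := fun K k X t =>
    (B₃ * Real.exp (-δ₀ * distCT (domCount (F.P K) M (k + 1)) M (fun i => (ZMod.cast ((t) i) : ZMod (domCount (F.P K) M (k + 1) * M))) (nearT (M := M) (fun i => (ZMod.cast ((t) i) : ZMod (domCount (F.P K) M (k + 1) * M))) X)))
  have hw0 : ∀ (X : (domSys (F.P K) M (k + 1)).Dom) (t : Site (F.P K) (k + 1)), 0 < wt K k X t := fun X t => tailWeight_pos _ X hB₃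
  have hwmono : ∀ (Z X : (domSys (F.P K) M (k + 1)).Dom), Z.1 ⊆ X.1 → ∀ t : Site (F.P K) (k + 1), wt K k Z t ≤ wt K k X t :=
    fun Z X h t => tailWeight_mono _ h hB₃.le hδ₀
  exact norm_jointChart_le (wt K k) hA hw0 hwmono hZX (slope_mem_Icc hω0 hω1 k m) hp

include hS

/-- ★ **`hfℋ` HOLDS AT THE MODEL**: at a real coupling `t` and the complexified real probe field `ι_X B = (B_{l,s}·w_X(s))` the joint chart takes the value
`H(Z; (h|h_m:=t)_{≤k}; emb(e^{iB}))` of the real U(1) activity at the updated history read through `emb W = (b ↦ ½(W_{b.dir}(t_b) + W_{b.dir}(t_b)⁻¹), 0)` and the chart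
`ρ = (x ↦ ix)` (part 1 `jointChart_agree` + `sum_histPrefix_update`). [folklore] -/
theorem hAgree_realU1 (γ : ℝ) (hB₃ : 0 < B₃) :
    ∀ (K k : ℕ), ∀ h ∈ Window γ, ∀ (m : ℕ) (X Z : (domSys (F.P K) M (k + 1)).Dom), Z.1 ⊆ X.1 → ∀ t ∈ Ioc (0 : ℝ) γ,
      ∀ Bf : Fin (F.P K).d → Site (F.P K) (k + 1) → ℝ,
        (fun (K k : ℕ) (h : ℕ → ℝ) (m : ℕ) (X Z : (domSys (F.P K) M (k + 1)).Dom) (p : ℂ × (Fin (F.P K).d → Site (F.P K) (k + 1) → ℂ)) =>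
        ((A * Real.exp (-(R * (domSys (F.P K) M (k + 1)).dj Z)) : ℝ) : ℂ) *
            Complex.cos (((∑ j : Fin (k + 1), histPrefix (Function.update h m 0) k j * ω ^ (k + 1 - (j : ℕ)) : ℝ) : ℂ) +
              p.1 * ((if m < k + 1 then ω ^ (k + 1 - m) else 0 : ℝ) : ℂ)) *
          (((Fintype.card (Fin (F.P K).d × Site (F.P K) (k + 1)) : ℂ))⁻¹ *
            ∑ lt : Fin (F.P K).d × Site (F.P K) (k + 1), ((Real.exp (-(r / (B₃ * Real.exp (-δ₀ * distCT (domCount (F.P K) M (k + 1)) M (fun i => (ZMod.cast (((blockIter (k + 1) (embIter (k + 1) lt.2))) i) : ZMod (domCount (F.P K) M (k + 1) * M))) (nearT (M := M) (fun i => (ZMod.cast (((blockIter (k + 1) (embIter (k + 1) lt.2))) i) : ZMod (domCount (F.P K) M (k + 1) * M))) Z))))) : ℝ) : ℂ) *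
              Complex.cos (p.2 lt.1 (blockIter (k + 1) (embIter (k + 1) lt.2)) / (((B₃ * Real.exp (-δ₀ * distCT (domCount (F.P K) M (k + 1)) M (fun i => (ZMod.cast (((blockIter (k + 1) (embIter (k + 1) lt.2))) i) : ZMod (domCount (F.P K) M (k + 1) * M))) (nearT (M := M) (fun i => (ZMod.cast (((blockIter (k + 1) (embIter (k + 1) lt.2))) i) : ZMod (domCount (F.P K) M (k + 1) * M))) X))) : ℝ) : ℂ)))) K k h m X Z
            ((t : ℂ), (fun (K k : ℕ) (X : (domSys (F.P K) M (k + 1)).Dom) => (LinearMap.toContinuousLinearMap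
      { toFun := fun B : Fin (F.P K).d → Site (F.P K) (k + 1) → ℝ => fun l t => ((B l t : ℝ) : ℂ) * (((B₃ * Real.exp (-δ₀ * distCT (domCount (F.P K) M (k + 1)) M (fun i => (ZMod.cast ((t) i) : ZMod (domCount (F.P K) M (k + 1) * M))) (nearT (M := M) (fun i => (ZMod.cast ((t) i) : ZMod (domCount (F.P K) M (k + 1) * M))) X))) : ℝ) : ℂ)
        map_add' := fun B B' => by funext l t; simp only [Pi.add_apply]; push_cast; ring
        map_smul' := fun c B => by funext l t; simp only [Pi.smul_apply, smul_eq_mul, RingHom.id_apply, Complex.real_smul]; push_cast; ring } :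
      (Fin (F.P K).d → Site (F.P K) (k + 1) → ℝ) →L[ℝ] (Fin (F.P K).d → Site (F.P K) (k + 1) → ℂ))) K k X Bf) =
          ((S K) k).H (histPrefix (Function.update h m t) k)
            ((fun (K k : ℕ) (W : Fin (F.P K).d → Site (F.P K) (k + 1) → ℂ) =>
        (((fun b : PBond (F.P K) 0 => (W b.dir (blockIter (k + 1) b.src) + (W b.dir (blockIter (k + 1) b.src))⁻¹) / 2), fun _ => (0 : ℂ)) : CPair (F.P K) ℂ)) K k
              (fun l u => NormedSpace.exp (((ContinuousLinearMap.id ℝ ℝ).smulRight Complex.I) (Bf l u)))) Z := by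
  intro K k h _ m X Z _ t _ Bf
  let wt : (K k : ℕ) → (domSys (F.P K) M (k + 1)).Dom → Site (F.P K) (k + 1) → ℝ := fun K k X t =>
    (B₃ * Real.exp (-δ₀ * distCT (domCount (F.P K) M (k + 1)) M (fun i => (ZMod.cast ((t) i) : ZMod (domCount (F.P K) M (k + 1) * M))) (nearT (M := M) (fun i => (ZMod.cast ((t) i) : ZMod (domCount (F.P K) M (k + 1) * M))) X)))
  have hw0 : ∀ (X : (domSys (F.P K) M (k + 1)).Dom) (t : Site (F.P K) (k + 1)), 0 < wt K k X t := fun X t => tailWeight_pos _ X hB₃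
  rw [LinearMap.coe_toContinuousLinearMap']
  exact jointChart_agree ((S K) k) (wt K k) (hS K k) X (hw0 X) Z _ t (sum_histPrefix_update ω h k m t) Bf

/-- ★ **THE REALITY BINDER `hIm` OF C4 §2 ∕ C6 §3 HOLDS AT THE MODEL**: the real U(1) towers' (2.13) terms at every history, read through `emb` after the chart `x ↦ ix` at a
REAL probe field, are REAL (part 1 `E_im_eq_zero_realU1` + `half_exp_add_inv_im`). [folklore] -/
theorem hIm_realU1 (γ : ℝ) :
    ∀ (K k : ℕ), ∀ h ∈ Window γ, ∀ (m : ℕ) (X : (domSys (F.P K) M (k + 1)).Dom), ∀ t ∈ Ioc (0 : ℝ) γ,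
      ∀ Bf : Fin (F.P K).d → Site (F.P K) (k + 1) → ℝ,
        (((S K) k).E (histPrefix (Function.update h m t) k)
            ((fun (K k : ℕ) (W : Fin (F.P K).d → Site (F.P K) (k + 1) → ℂ) =>
        (((fun b : PBond (F.P K) 0 => (W b.dir (blockIter (k + 1) b.src) + (W b.dir (blockIter (k + 1) b.src))⁻¹) / 2), fun _ => (0 : ℂ)) : CPair (F.P K) ℂ)) K k
              (fun l u => NormedSpace.exp (((ContinuousLinearMap.id ℝ ℝ).smulRight Complex.I) (Bf l u)))) X).im = 0 := by
  intro K k h _ m X t _ Bf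
  let wt : (K k : ℕ) → (domSys (F.P K) M (k + 1)).Dom → Site (F.P K) (k + 1) → ℝ := fun K k X t =>
    (B₃ * Real.exp (-δ₀ * distCT (domCount (F.P K) M (k + 1)) M (fun i => (ZMod.cast ((t) i) : ZMod (domCount (F.P K) M (k + 1) * M))) (nearT (M := M) (fun i => (ZMod.cast ((t) i) : ZMod (domCount (F.P K) M (k + 1) * M))) X)))
  exact E_im_eq_zero_realU1 ((S K) k) (wt K k) (hS K k) _ X _ fun b => half_exp_add_inv_im _

open Classical in
/-- ★★ **C6 §2 FIRES AT THE REAL U(1) MODEL — PER-TERM JOINT (coupling, field) OUTPUT CHARTS WITH THE (1.18)-TYPE BOUND, NON-DEGENERATELY.**  For every family `F`, cube side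
`M`, towers `S` whose activities ARE the real U(1) display, `0 ≤ A`, `0 ≤ ω ≤ 1`, `δ₀ ≥ 0`, `B₃ > 0`, any strip half-width `s`, window `γ`, and Road 1's
numerals for the amplitude `A e^{s}` (`0 ≤ r₁`, `r₁ + 128 log 162 + 2 ≤ R`, `A e^{s}·e^{5r₁+1}·K₀(64,8)·9·64 ≤ 1`): ALL hypotheses of
`JointHoloLocalTerms.jointCharts_of_activityJointCharts` (p631151 §2) hold — towers `S`, reading `emb` (self-adjoint part of the pulled-back holonomy), chart `x ↦ ix`,
`Ec K k = (Fin d → Site_{k+1} → ℂ)`, dag-n22-w2's injective tail-weight complexification `ι`, `Dt = {|Im τ| < s}`, the joint charts `ℋ` (§5 `hHolo ∕ hBound ∕ hAgree_realU1`)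
— so it APPLIES and returns its three OUTPUT-chart binders `h𝒢 ∕ hM𝒢 ∕ hf` for `𝒢 := locE ∘ ℋ` with letters `(B, κ_E) = (e·9·64·K₀(64,8)²·A e^{s}, r₁)`: the per-term JOINT
output charts of C4 §2 at a model whose activities read the configuration AND every coupling.  MODEL witness (declared) — NOT NODE 00's towers. [folklore] -/
theorem jointCharts_of_activityJointCharts_fires_realU1 (γ s : ℝ) {r₁ : ℝ} (hA : 0 ≤ A) (hω0 : 0 ≤ ω) (hω1 : ω ≤ 1) (hδ₀ : 0 ≤ δ₀) (hB₃ : 0 < B₃)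
    (hr₁ : 0 ≤ r₁) (hrate : r₁ + 2 * (64 * Real.log 162) + 2 ≤ R) (hsmall : A * Real.exp s * Real.exp (5 * r₁ + 1) * K₀ 64 8 * 9 * 64 ≤ 1) :
    (∀ (K k : ℕ), ∀ h ∈ Window γ, ∀ (m : ℕ) (X : (domSys (F.P K) M (k + 1)).Dom),
      DifferentiableOn ℂ (fun p : ℂ × (Fin (F.P K).d → Site (F.P K) (k + 1) → ℂ) =>
        locE (TTouch (d := 4) (N := domCount (F.P K) M (k + 1))) (fun Z : (domSys (F.P K) M (k + 1)).Dom => Z.1)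
          (fun Z => (fun (K k : ℕ) (h : ℕ → ℝ) (m : ℕ) (X Z : (domSys (F.P K) M (k + 1)).Dom) (p : ℂ × (Fin (F.P K).d → Site (F.P K) (k + 1) → ℂ)) =>
        ((A * Real.exp (-(R * (domSys (F.P K) M (k + 1)).dj Z)) : ℝ) : ℂ) *
            Complex.cos (((∑ j : Fin (k + 1), histPrefix (Function.update h m 0) k j * ω ^ (k + 1 - (j : ℕ)) : ℝ) : ℂ) +
              p.1 * ((if m < k + 1 then ω ^ (k + 1 - m) else 0 : ℝ) : ℂ)) *
          (((Fintype.card (Fin (F.P K).d × Site (F.P K) (k + 1)) : ℂ))⁻¹ *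
            ∑ lt : Fin (F.P K).d × Site (F.P K) (k + 1), ((Real.exp (-(r / (B₃ * Real.exp (-δ₀ * distCT (domCount (F.P K) M (k + 1)) M (fun i => (ZMod.cast (((blockIter (k + 1) (embIter (k + 1) lt.2))) i) : ZMod (domCount (F.P K) M (k + 1) * M))) (nearT (M := M) (fun i => (ZMod.cast (((blockIter (k + 1) (embIter (k + 1) lt.2))) i) : ZMod (domCount (F.P K) M (k + 1) * M))) Z))))) : ℝ) : ℂ) *
              Complex.cos (p.2 lt.1 (blockIter (k + 1) (embIter (k + 1) lt.2)) / (((B₃ * Real.exp (-δ₀ * distCT (domCount (F.P K) M (k + 1)) M (fun i => (ZMod.cast (((blockIter (k + 1) (embIter (k + 1) lt.2))) i) : ZMod (domCount (F.P K) M (k + 1) * M))) (nearT (M := M) (fun i => (ZMod.cast (((blockIter (k + 1) (embIter (k + 1) lt.2))) i) : ZMod (domCount (F.P K) M (k + 1) * M))) X))) : ℝ) : ℂ)))) K k h m X Z p) X.1)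
        ({τ : ℂ | |τ.im| < s} ×ˢ ball (0 : Fin (F.P K).d → Site (F.P K) (k + 1) → ℂ) r)) ∧
    (∀ (K k : ℕ), ∀ h ∈ Window γ, ∀ (m : ℕ) (X : (domSys (F.P K) M (k + 1)).Dom),
      ∀ p ∈ {τ : ℂ | |τ.im| < s} ×ˢ ball (0 : Fin (F.P K).d → Site (F.P K) (k + 1) → ℂ) r,
        ‖locE (TTouch (d := 4) (N := domCount (F.P K) M (k + 1))) (fun Z : (domSys (F.P K) M (k + 1)).Dom => Z.1)
            (fun Z => (fun (K k : ℕ) (h : ℕ → ℝ) (m : ℕ) (X Z : (domSys (F.P K) M (k + 1)).Dom) (p : ℂ × (Fin (F.P K).d → Site (F.P K) (k + 1) → ℂ)) =>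
        ((A * Real.exp (-(R * (domSys (F.P K) M (k + 1)).dj Z)) : ℝ) : ℂ) *
            Complex.cos (((∑ j : Fin (k + 1), histPrefix (Function.update h m 0) k j * ω ^ (k + 1 - (j : ℕ)) : ℝ) : ℂ) +
              p.1 * ((if m < k + 1 then ω ^ (k + 1 - m) else 0 : ℝ) : ℂ)) *
          (((Fintype.card (Fin (F.P K).d × Site (F.P K) (k + 1)) : ℂ))⁻¹ *
            ∑ lt : Fin (F.P K).d × Site (F.P K) (k + 1), ((Real.exp (-(r / (B₃ * Real.exp (-δ₀ * distCT (domCount (F.P K) M (k + 1)) M (fun i => (ZMod.cast (((blockIter (k + 1) (embIter (k + 1) lt.2))) i) : ZMod (domCount (F.P K) M (k + 1) * M))) (nearT (M := M) (fun i => (ZMod.cast (((blockIter (k + 1) (embIter (k + 1) lt.2))) i) : ZMod (domCount (F.P K) M (k + 1) * M))) Z))))) : ℝ) : ℂ) *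
              Complex.cos (p.2 lt.1 (blockIter (k + 1) (embIter (k + 1) lt.2)) / (((B₃ * Real.exp (-δ₀ * distCT (domCount (F.P K) M (k + 1)) M (fun i => (ZMod.cast (((blockIter (k + 1) (embIter (k + 1) lt.2))) i) : ZMod (domCount (F.P K) M (k + 1) * M))) (nearT (M := M) (fun i => (ZMod.cast (((blockIter (k + 1) (embIter (k + 1) lt.2))) i) : ZMod (domCount (F.P K) M (k + 1) * M))) X))) : ℝ) : ℂ)))) K k h m X Z p) X.1‖ ≤
          (Real.exp 1 * 9 * 64 * K₀ 64 8 ^ 2 * (A * Real.exp s)) * Real.exp (-(r₁ * (domSys (F.P K) M (k + 1)).dj X))) ∧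
    (∀ (K k : ℕ), ∀ h ∈ Window γ, ∀ (m : ℕ) (X : (domSys (F.P K) M (k + 1)).Dom), ∀ t ∈ Ioc (0 : ℝ) γ,
      ∀ Bf : Fin (F.P K).d → Site (F.P K) (k + 1) → ℝ,
        locE (TTouch (d := 4) (N := domCount (F.P K) M (k + 1))) (fun Z : (domSys (F.P K) M (k + 1)).Dom => Z.1)
            (fun Z => (fun (K k : ℕ) (h : ℕ → ℝ) (m : ℕ) (X Z : (domSys (F.P K) M (k + 1)).Dom) (p : ℂ × (Fin (F.P K).d → Site (F.P K) (k + 1) → ℂ)) =>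
        ((A * Real.exp (-(R * (domSys (F.P K) M (k + 1)).dj Z)) : ℝ) : ℂ) *
            Complex.cos (((∑ j : Fin (k + 1), histPrefix (Function.update h m 0) k j * ω ^ (k + 1 - (j : ℕ)) : ℝ) : ℂ) +
              p.1 * ((if m < k + 1 then ω ^ (k + 1 - m) else 0 : ℝ) : ℂ)) *
          (((Fintype.card (Fin (F.P K).d × Site (F.P K) (k + 1)) : ℂ))⁻¹ *
            ∑ lt : Fin (F.P K).d × Site (F.P K) (k + 1), ((Real.exp (-(r / (B₃ * Real.exp (-δ₀ * distCT (domCount (F.P K) M (k + 1)) M (fun i => (ZMod.cast (((blockIter (k + 1) (embIter (k + 1) lt.2))) i) : ZMod (domCount (F.P K) M (k + 1) * M))) (nearT (M := M) (fun i => (ZMod.cast (((blockIter (k + 1) (embIter (k + 1) lt.2))) i) : ZMod (domCount (F.P K) M (k + 1) * M))) Z))))) : ℝ) : ℂ) *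
              Complex.cos (p.2 lt.1 (blockIter (k + 1) (embIter (k + 1) lt.2)) / (((B₃ * Real.exp (-δ₀ * distCT (domCount (F.P K) M (k + 1)) M (fun i => (ZMod.cast (((blockIter (k + 1) (embIter (k + 1) lt.2))) i) : ZMod (domCount (F.P K) M (k + 1) * M))) (nearT (M := M) (fun i => (ZMod.cast (((blockIter (k + 1) (embIter (k + 1) lt.2))) i) : ZMod (domCount (F.P K) M (k + 1) * M))) X))) : ℝ) : ℂ)))) K k h m X Z
              ((t : ℂ), (fun (K k : ℕ) (X : (domSys (F.P K) M (k + 1)).Dom) => (LinearMap.toContinuousLinearMap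
      { toFun := fun B : Fin (F.P K).d → Site (F.P K) (k + 1) → ℝ => fun l t => ((B l t : ℝ) : ℂ) * (((B₃ * Real.exp (-δ₀ * distCT (domCount (F.P K) M (k + 1)) M (fun i => (ZMod.cast ((t) i) : ZMod (domCount (F.P K) M (k + 1) * M))) (nearT (M := M) (fun i => (ZMod.cast ((t) i) : ZMod (domCount (F.P K) M (k + 1) * M))) X))) : ℝ) : ℂ)
        map_add' := fun B B' => by funext l t; simp only [Pi.add_apply]; push_cast; ring
        map_smul' := fun c B => by funext l t; simp only [Pi.smul_apply, smul_eq_mul, RingHom.id_apply, Complex.real_smul]; push_cast; ring } :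
      (Fin (F.P K).d → Site (F.P K) (k + 1) → ℝ) →L[ℝ] (Fin (F.P K).d → Site (F.P K) (k + 1) → ℂ))) K k X Bf)) X.1 =
          ((S K) k).E (histPrefix (Function.update h m t) k)
            ((fun (K k : ℕ) (W : Fin (F.P K).d → Site (F.P K) (k + 1) → ℂ) =>
        (((fun b : PBond (F.P K) 0 => (W b.dir (blockIter (k + 1) b.src) + (W b.dir (blockIter (k + 1) b.src))⁻¹) / 2), fun _ => (0 : ℂ)) : CPair (F.P K) ℂ)) K k
              (fun l u => NormedSpace.exp (((ContinuousLinearMap.id ℝ ℝ).smulRight Complex.I) (Bf l u)))) X) := by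
  have hA' : 0 ≤ A * Real.exp s := by positivity
  exact jointCharts_of_activityJointCharts F S
    (fun (K k : ℕ) (W : Fin (F.P K).d → Site (F.P K) (k + 1) → ℂ) =>
        (((fun b : PBond (F.P K) 0 => (W b.dir (blockIter (k + 1) b.src) + (W b.dir (blockIter (k + 1) b.src))⁻¹) / 2), fun _ => (0 : ℂ)) : CPair (F.P K) ℂ))
    ((ContinuousLinearMap.id ℝ ℝ).smulRight Complex.I) hA' hr₁ hrate hsmall
    (fun K k => Fin (F.P K).d → Site (F.P K) (k + 1) → ℂ)
    (fun (K k : ℕ) (X : (domSys (F.P K) M (k + 1)).Dom) => (LinearMap.toContinuousLinearMap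
      { toFun := fun B : Fin (F.P K).d → Site (F.P K) (k + 1) → ℝ => fun l t => ((B l t : ℝ) : ℂ) * (((B₃ * Real.exp (-δ₀ * distCT (domCount (F.P K) M (k + 1)) M (fun i => (ZMod.cast ((t) i) : ZMod (domCount (F.P K) M (k + 1) * M))) (nearT (M := M) (fun i => (ZMod.cast ((t) i) : ZMod (domCount (F.P K) M (k + 1) * M))) X))) : ℝ) : ℂ)
        map_add' := fun B B' => by funext l t; simp only [Pi.add_apply]; push_cast; ring
        map_smul' := fun c B => by funext l t; simp only [Pi.smul_apply, smul_eq_mul, RingHom.id_apply, Complex.real_smul]; push_cast; ring } :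
      (Fin (F.P K).d → Site (F.P K) (k + 1) → ℝ) →L[ℝ] (Fin (F.P K).d → Site (F.P K) (k + 1) → ℂ)))
    (isOpen_setOf_abs_im_lt s)
    (fun (K k : ℕ) (h : ℕ → ℝ) (m : ℕ) (X Z : (domSys (F.P K) M (k + 1)).Dom) (p : ℂ × (Fin (F.P K).d → Site (F.P K) (k + 1) → ℂ)) =>
        ((A * Real.exp (-(R * (domSys (F.P K) M (k + 1)).dj Z)) : ℝ) : ℂ) *
            Complex.cos (((∑ j : Fin (k + 1), histPrefix (Function.update h m 0) k j * ω ^ (k + 1 - (j : ℕ)) : ℝ) : ℂ) +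
              p.1 * ((if m < k + 1 then ω ^ (k + 1 - m) else 0 : ℝ) : ℂ)) *
          (((Fintype.card (Fin (F.P K).d × Site (F.P K) (k + 1)) : ℂ))⁻¹ *
            ∑ lt : Fin (F.P K).d × Site (F.P K) (k + 1), ((Real.exp (-(r / (B₃ * Real.exp (-δ₀ * distCT (domCount (F.P K) M (k + 1)) M (fun i => (ZMod.cast (((blockIter (k + 1) (embIter (k + 1) lt.2))) i) : ZMod (domCount (F.P K) M (k + 1) * M))) (nearT (M := M) (fun i => (ZMod.cast (((blockIter (k + 1) (embIter (k + 1) lt.2))) i) : ZMod (domCount (F.P K) M (k + 1) * M))) Z))))) : ℝ) : ℂ) *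
              Complex.cos (p.2 lt.1 (blockIter (k + 1) (embIter (k + 1) lt.2)) / (((B₃ * Real.exp (-δ₀ * distCT (domCount (F.P K) M (k + 1)) M (fun i => (ZMod.cast (((blockIter (k + 1) (embIter (k + 1) lt.2))) i) : ZMod (domCount (F.P K) M (k + 1) * M))) (nearT (M := M) (fun i => (ZMod.cast (((blockIter (k + 1) (embIter (k + 1) lt.2))) i) : ZMod (domCount (F.P K) M (k + 1) * M))) X))) : ℝ) : ℂ))))
    (hHolo_realU1 F M γ s) (hBound_realU1 F M γ s hA hω0 hω1 hδ₀ hB₃) (hAgree_realU1 F M S hS γ hB₃)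

end Tower

end YMDAG.N22.JointHoloLocalTerms.RealU1

end
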